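import Literature.Computability.AlgebraicComplexity.AlmanLi2026AppendDirectSum
import Literature.Computability.AlgebraicComplexity.AlmanLi2026GeneralTensorBound
import Literature.Computability.AlgebraicComplexity.AlmanLi2026Bootstrap
import HarnessLib

/-!
# The quantitative form of Thm. 6.3 (Alman–Li 2026, §6): `R̃(T) ≤ r − (2^{2/3} − 1)·p·n^{2/3}` for `T ⊴ ⟨r⟩`, `p = ⌊r/3n⌋`

Topic `Literature/Computability/AlgebraicComplexity` (family `MatrixMultiplication`). Source: J. Alman,
B. Li, *Asymptotic Rank Speedup Theorems, Revisited*, arXiv:2605.21738 (2026), §6, the discussion after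
the proofs of Thm. 6.3 (held text `paper:arxiv-2605.21738`, p0016 L57–62): "We now discuss the
quantitative advantage of this method compared with previous ones. Using the naive asymptotic
assumption `s ≤ n`, one can take `p = Ω(r/n)` and let every `r_α ≥ 3n`. This gives the degeneration
`T ⊕ p⊙⟨1,2n,1⟩ ⊴ ⟨r⟩ ⊕ p⊙⟨1,n,1⟩`, and similar statements hold for the other two directions.
Strassen calculus then yields an upper bound `R̃(T) ≤ r − (2^{2/3} − 1) p n^{2/3} = r − Ω(r/n^{1/3})`,
which is a superior bound when `r = ω(n)`."  (Setting of Thm. 6.3: "Let `T ⊴ ⟨r⟩` …".)  Also the last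
clause of Thm. 6.1 (p0015 L24–30): "In particular, if `r ≥ n`, we have
`T ⊕ ⟨1, r−n, 1⟩ ⊴ ⟨r⟩ ⊕ ⟨1, n, 1⟩`, and for `r > 2n`, this provides the strict improvement
`R̃(T) ≤ r + n^{2/3} − (r−n)^{2/3} < r`."

This file PROVES those displays and bounds for cubic tensors `T : Fin n → Fin n → Fin n → K` over any
field with `T ⊴ ⟨r⟩` (the tree's `AlgDegeneratesTo (unitTensor K r) T`, i.e. border rank `≤ r`), by
the printed route: the border-rank data are a restriction of `⟨r⟩` over `L = K(λ)` onto
`T_λ = λ^h T + O(λ^{h+1})`; the `λ`-free theorems (`AlmanLi2026.thm63_rankDecomposition_blocks`,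
`AlmanLi2026.thm61_rankDecomposition_fintype`, with `c' = 1` and `s = n ≥ rank M` automatic for an
`n × n` matrix) are applied over the FIELD `L`; the slice block is rescaled by `λ^h` and the result is
bootstrapped down to `K` by Cor. 5.1 (`AlmanLi2026.algDegeneratesTo_of_isFractionRing`); then the
three directions and Strassen duality (Prop. 4.5):

* `AlmanLi2026.exists_polynomialFamily_of_algDegeneratesTo_unit` — `T ⊴ ⟨r⟩` over `K` ⟹ a
  `K[λ]`-tensor `P = λ^h T + O(λ^{h+1})` whose image over `K(λ)` is a restriction of `⟨r⟩`.
* `AlmanLi2026.blocks_degeneration_of_restrictsTo` (`⟨r⟩ ≥ X`, any field) and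
  `AlmanLi2026.blocks_degeneration` (`T ⊴ ⟨r⟩`): `3np ≤ r` ⟹ `⟨r⟩ ⊕ p⊙⟨n-slice⟩ ⊵ T ⊕ p⊙⟨2n-slice⟩`.
* `AlmanLi2026.thm63_spectral` — at a universal spectral point: `φ(T) + p(2n)^{θᵢ} ≤ r + p n^{θᵢ}` in
  the three directions.
* **`AlmanLi2026.asymptoticRank_le_of_algDegeneratesTo_blocks`** — `T ⊴ ⟨r⟩`, `3np ≤ r`, `n ≥ 1` ⟹
  `R̃(T) ≤ r − (2^{2/3} − 1)·p·n^{2/3}` (largest exponent `θᵢ ≥ 2/3`, `τ(θ) = (2n)^θ − n^θ`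
  increasing, Strassen duality — as in Prop. 4.5); corollaries `…_of_algBorderRank_le_blocks`
  (`bR(T) ≤ r`) and `…_of_tensorRank_le_blocks` (`R(T) ≤ r`).
* `AlmanLi2026.thm61_degeneration_of_decomposition` — **Thm. 6.1 as printed**: border-rank data
  `∑ᵢ uᵢ ⊗ vᵢ ⊗ wᵢ = T + O(λ)` over `K(λ)` and nonzero `c'ᵢ ∈ K(λ)` with `rank ∑ᵢ c'ᵢuᵢvᵢᵀ ≤ s` ⟹
  `T ⊕ ⟨1, r+s−2n, 1⟩ ⊴ ⟨r⟩ ⊕ ⟨1, s, 1⟩` over `K`.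
* `AlmanLi2026.thm61_degeneration_of_restrictsTo` / `AlmanLi2026.thm61_degeneration` — the display
  `⟨r⟩ ⊕ ⟨n-slice⟩ ⊵ T ⊕ ⟨(r−n)-slice⟩`, and **`AlmanLi2026.thm61_asymptoticRank_le`** — `T ⊴ ⟨r⟩`,
  `r > 2n`, `n ≥ 1` ⟹ `R̃(T) ≤ r + n^{2/3} − (r−n)^{2/3}` (Prop. 4.5, Case 1); corollaries for
  `bR(T) ≤ r` and `R(T) ≤ r`.

No definitions, no named facts.

## References

* J. Alman, B. Li, *Asymptotic Rank Speedup Theorems, Revisited*, arXiv:2605.21738 (2026), §6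
  (p0016 L57–62), Thm. 6.1, Thm. 6.3, Cor. 5.1 (proof), Prop. 4.5. [AlmanLi2026]
-/

noncomputable section

open scoped BigOperators Polynomial

namespace Literature.Computability.AlgebraicComplexity

namespace AlmanLi2026

section Plumbing

variable {K : Type} [CommSemiring K] {ι κ μ ι' κ' μ' : Type}

/-- A triple sum against the unit tensor collapses to the diagonal. [folklore] -/
private theorem sum_unitTensor_eq₆ {r : ℕ} (F G H : Fin r → K) :
    (∑ a, ∑ b, ∑ c, F a * G b * H c * unitTensor K r a b c) = ∑ i, F i * G i * H i := by
  refine Finset.sum_congr rfl fun i _ => ?_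
  rw [Finset.sum_eq_single i (fun j _ hj => by simp [Ne.symm hj]) (by simp),
    Finset.sum_eq_single i (fun k _ hk => by simp [Ne.symm hk]) (by simp)]
  simp

/-- `rotate (s ⊕ t) = rotate s ⊕ rotate t`. [folklore] -/
private theorem rotate_directSum₆ (s : ι → κ → μ → K) (t : ι' → κ' → μ' → K) :
    rotate (directSumTensor s t) = directSumTensor (rotate s) (rotate t) := by
  funext b c a
  rcases a with a | a <;> rcases b with b | b <;> rcases c with c | c <;> rfl

/-- `rotate (s ⊠ t) = rotate s ⊠ rotate t`. [folklore] -/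
private theorem rotate_kronecker₆ (s : ι → κ → μ → K) (t : ι' → κ' → μ' → K) :
    rotate (kroneckerTensor s t) = kroneckerTensor (rotate s) (rotate t) := by
  funext b c a
  simp [rotate_apply, kroneckerTensor_apply]

/-- `rotate ⟨n⟩ = ⟨n⟩`. [folklore] -/
private theorem rotate_unit₆ (n : ℕ) : rotate (unitTensor K n) = unitTensor K n := by
  funext b c a
  simp only [rotate_apply, unitTensor_apply]
  exact if_congr ⟨fun ⟨h1, h2⟩ => ⟨h2, (h1.trans h2).symm⟩, fun ⟨h1, h2⟩ => ⟨(h1.trans h2).symm, h1⟩⟩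
    rfl rfl

omit [CommSemiring K] in
/-- `rotate³ = id`. [folklore] -/
private theorem rotate_rotate_rotate₆ (t : ι → κ → μ → K) : rotate (rotate (rotate t)) = t := rfl

end Plumbing

/-! ## Border-rank data over `L = K(λ)` and the bootstrapping plumbing -/

section BaseChange

variable {K : Type} [Field K] {ι κ μ ι' κ' μ' : Type}

/-- **Border-rank data as a restriction over `K(λ)`** ("Let `{aᵢ}, {bᵢ}, {cᵢ}` be the `𝔽(λ)`-vectors
representing the border rank decomposition, i.e. `∑ᵢ aᵢbᵢcᵢ = T + O(λ)`"): a degeneration `⟨r⟩ ⊵ T`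
over `K` (order `h`, polynomial matrices `A, B, C`) gives the `K[λ]`-tensor
`P = ∑ᵢ Aᵢ ⊗ Bᵢ ⊗ Cᵢ = λ^h T + O(λ^{h+1})`, whose image over `L = K(λ)` is a restriction of `⟨r⟩`.
[cite: AlmanLi2026, Thm. 6.1 (statement: "the 𝔽(λ)-vectors representing the border rank decomposition")] -/
theorem exists_polynomialFamily_of_algDegeneratesTo_unit [Fintype ι] [Fintype κ] [Fintype μ]
    {r : ℕ} {T : ι → κ → μ → K} (hT : AlgDegeneratesTo (unitTensor K r) T) :
    ∃ (h : ℕ) (P : ι → κ → μ → K[X]),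
      (∀ a b c, ∀ j ≤ h, (P a b c).coeff j = if j = h then T a b c else 0) ∧
      TensorRestrictsTo (unitTensor (RatFunc K) r)
        (fun a b c => algebraMap K[X] (RatFunc K) (P a b c)) := by
  obtain ⟨h, A, B, C, hABC⟩ := hT
  refine ⟨h, fun a b c => ∑ i, A a i * B b i * C c i, fun a b c j hj => ?_, ?_⟩
  · have e : (∑ i, ∑ i', ∑ i'', A a i * B b i' * C c i'' * Polynomial.C (unitTensor K r i i' i'')) =
        ∑ i, A a i * B b i * C c i := by
      refine Finset.sum_congr rfl fun i _ => ?_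
      rw [Finset.sum_eq_single i (fun j _ hj => by simp [Ne.symm hj]) (by simp),
        Finset.sum_eq_single i (fun k _ hk => by simp [Ne.symm hk]) (by simp)]
      simp
    show (∑ i, A a i * B b i * C c i).coeff j = _
    rw [← e]
    exact hABC a b c j hj
  · refine ⟨fun a i => algebraMap K[X] (RatFunc K) (A a i),
      fun b i => algebraMap K[X] (RatFunc K) (B b i),
      fun c i => algebraMap K[X] (RatFunc K) (C c i), fun a b c => ?_⟩
    simp only [map_sum, map_mul]
    exact (sum_unitTensor_eq₆ (K := RatFunc K) (fun i => algebraMap K[X] (RatFunc K) (A a i))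
      (fun i => algebraMap K[X] (RatFunc K) (B b i)) fun i => algebraMap K[X] (RatFunc K) (C c i)).symm

/-- **"We may scale by `λ`"**: rescaling a direct summand by `λ^h` is a restriction over `L ⊇ K[λ]`,
`Y ⊕ Z ≥ Y ⊕ λ^h·Z`, read on the images of the `K[λ]`-tensors. [cite: AlmanLi2026, Cor. 5.1 (proof)] -/
theorem restrictsTo_directSum_X_pow_mul {L : Type} [Field L] [Algebra K[X] L]
    [Fintype ι] [Fintype κ] [Fintype μ] [Fintype ι'] [Fintype κ'] [Fintype μ']
    [DecidableEq ι] [DecidableEq κ] [DecidableEq μ] [DecidableEq ι'] [DecidableEq κ'] [DecidableEq μ']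
    (P : ι → κ → μ → K[X]) (Z : ι' → κ' → μ' → K) (h : ℕ) :
    TensorRestrictsTo
      (directSumTensor (fun a b c => algebraMap K[X] L (P a b c))
        (fun x y z => algebraMap K[X] L (Polynomial.C (Z x y z))))
      (fun a b c => algebraMap K[X] L
        (directSumTensor P (fun x y z => Polynomial.X ^ h * Polynomial.C (Z x y z)) a b c)) := by
  refine ⟨fun a a' => if a' = a then 1 else 0, fun b b' => if b' = b then 1 else 0,
    fun c c' => if c' = c then Sum.elim (fun _ => (1 : L)) (fun _ => algebraMap K[X] L Polynomial.X ^ h) c else 0,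
    fun a b c => ?_⟩
  rw [Finset.sum_eq_single a (fun x _ hx => by simp [hx]) (by simp),
    Finset.sum_eq_single b (fun x _ hx => by simp [hx]) (by simp),
    Finset.sum_eq_single c (fun x _ hx => by simp [hx]) (by simp)]
  rcases a with a | a <;> rcases b with b | b <;> rcases c with c | c <;>
    simp [directSumTensor]
  exact mul_comm _ _

/-- The `λ`-adic lowest term of `P ⊕ λ^h·Z` is `T ⊕ Z` at order `h` when `P = λ^h T + O(λ^{h+1})`.
[cite: AlmanLi2026, Cor. 5.1 (proof)] -/
theorem coeff_directSum_X_pow_mul (P : ι → κ → μ → K[X]) (Z : ι' → κ' → μ' → K)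
    {T : ι → κ → μ → K} {h : ℕ}
    (hP : ∀ a b c, ∀ j ≤ h, (P a b c).coeff j = if j = h then T a b c else 0) :
    ∀ a b c, ∀ j ≤ h,
      (directSumTensor P (fun x y z => Polynomial.X ^ h * Polynomial.C (Z x y z)) a b c).coeff j =
        if j = h then directSumTensor T Z a b c else 0 := by
  intro a b c j hj
  rcases a with a | a <;> rcases b with b | b <;> rcases c with c | c
  · rw [directSumTensor_inl, directSumTensor_inl]
    exact hP a b c j hj
  · simp [directSumTensor]
  · simp [directSumTensor]
  · simp [directSumTensor]
  · simp [directSumTensor]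
  · simp [directSumTensor]
  · simp [directSumTensor]
  · rw [directSumTensor_inr, directSumTensor_inr, Polynomial.coeff_X_pow_mul', Polynomial.coeff_C]
    by_cases hjh : j = h
    · subst hjh
      simp
    · rw [if_neg hjh]
      split_ifs with h1 h2
      · omega
      · rfl
      · rfl

/-- Images of `0/1` tensors: `⟨r⟩ ⊕ ⟨s-slice⟩` over `L` is the image of `⟨r⟩ ⊕ ⟨s-slice⟩` over `K`.
[folklore] -/
private theorem directSum_unit_slice_eq_map₆ {L : Type} [CommRing L] [Algebra K[X] L] (r s : ℕ) :
    directSumTensor (unitTensor L r) (rotate (oneSliceTensor L (Fin s))) =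
      fun a b c => algebraMap K[X] L (Polynomial.C
        (directSumTensor (unitTensor K r) (rotate (oneSliceTensor K (Fin s))) a b c)) := by
  funext a b c
  rcases a with a | a <;> rcases b with b | b <;> rcases c with c | c <;>
    simp [directSumTensor, unitTensor_apply, rotate_apply, oneSliceTensor_apply, apply_ite Polynomial.C,
      apply_ite (algebraMap K[X] L)]

/-- Images of `0/1` tensors: `⟨r⟩ ⊕ ⟨p⟩⊠⟨s-slice⟩` over `L` is the image of the same over `K`.
[folklore] -/
private theorem directSum_unit_blocks_eq_map₆ {L : Type} [CommRing L] [Algebra K[X] L] (r p s : ℕ) :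
    directSumTensor (unitTensor L r)
        (kroneckerTensor (unitTensor L p) (rotate (oneSliceTensor L (Fin s)))) =
      fun a b c => algebraMap K[X] L (Polynomial.C
        (directSumTensor (unitTensor K r)
          (kroneckerTensor (unitTensor K p) (rotate (oneSliceTensor K (Fin s)))) a b c)) := by
  funext a b c
  rcases a with a | ⟨a₁, a₂⟩ <;> rcases b with b | ⟨b₁, b₂⟩ <;> rcases c with c | ⟨c₁, c₂⟩ <;>
    simp [directSumTensor, unitTensor_apply, kroneckerTensor_apply, rotate_apply, oneSliceTensor_apply,
      apply_ite Polynomial.C, apply_ite (algebraMap K[X] L)]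

/-- The image of `⟨s-slice⟩` over `K` is `⟨s-slice⟩` over `L`. [folklore] -/
private theorem map_rotate_oneSlice₆ {L : Type} [CommRing L] [Algebra K[X] L] (s : ℕ) :
    (fun x y z => algebraMap K[X] L (Polynomial.C (rotate (oneSliceTensor K (Fin s)) x y z))) =
      rotate (oneSliceTensor L (Fin s)) := by
  funext x y z
  simp [rotate_apply, oneSliceTensor_apply, apply_ite Polynomial.C, apply_ite (algebraMap K[X] L)]

/-- The image of `⟨p⟩⊠⟨s-slice⟩` over `K` is `⟨p⟩⊠⟨s-slice⟩` over `L`. [folklore] -/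
private theorem map_unit_kronecker_rotate_oneSlice₆ {L : Type} [CommRing L] [Algebra K[X] L]
    (p s : ℕ) :
    (fun x y z => algebraMap K[X] L (Polynomial.C
      (kroneckerTensor (unitTensor K p) (rotate (oneSliceTensor K (Fin s))) x y z))) =
      kroneckerTensor (unitTensor L p) (rotate (oneSliceTensor L (Fin s))) := by
  funext x y z
  simp [unitTensor_apply, kroneckerTensor_apply, rotate_apply, oneSliceTensor_apply,
    apply_ite Polynomial.C, apply_ite (algebraMap K[X] L)]

end BaseChange

section Blocks

variable (K : Type) [Field K]

/-- **The display `T ⊕ p⊙⟨1,2n,1⟩ ⊴ ⟨r⟩ ⊕ p⊙⟨1,n,1⟩`** (λ-free): if `⟨r⟩ ≥ X` for a cubic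
`X : Fin n → Fin n → Fin n → K` and `3np ≤ r`, then
`⟨r⟩ ⊕ ⟨p⟩⊠⟨n-slice⟩ ⊵ X ⊕ ⟨p⟩⊠⟨2n-slice⟩` (slices with trivial factor third): `p` groups of `3n`
columns of the decomposition, `c' = 1`, `s_α = n ≥ rank M_α` ("the naive assumption `s ≤ n`":
`M_α` is an `n × n` matrix), Thm. 6.3 (`thm63_rankDecomposition_blocks`).
[cite: AlmanLi2026, §6 (display after the proofs of Thm. 6.3)] -/
theorem blocks_degeneration_of_restrictsTo {n r p : ℕ} (X : Fin n → Fin n → Fin n → K)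
    (hX : TensorRestrictsTo (unitTensor K r) X) (hp : 3 * n * p ≤ r) :
    AlgDegeneratesTo
      (directSumTensor (unitTensor K r)
        (kroneckerTensor (unitTensor K p) (rotate (oneSliceTensor K (Fin n)))))
      (directSumTensor X
        (kroneckerTensor (unitTensor K p) (rotate (oneSliceTensor K (Fin (2 * n)))))) := by
  classical
  obtain ⟨A, B, C, hABC⟩ := hX
  have hX' : ∀ a b c, X a b c = ∑ i, A a i * B b i * C c i := fun a b c => by
    rw [hABC, sum_unitTensor_eq₆]
  -- regroup the `r` columns as `(r − 3np) ⊔ (p × 3n)`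
  set e : Fin (r - 3 * n * p) ⊕ (Fin p × Fin (3 * n)) ≃ Fin r :=
    ((Equiv.refl _).sumCongr finProdFinEquiv).trans (finSumFinEquiv.trans (finCongr (by
      rw [Nat.mul_comm p]; omega))) with he
  have hX'' : ∀ a b c, X a b c = ∑ k, A a (e k) * B b (e k) * C c (e k) := fun a b c => by
    rw [hX' a b c, ← e.sum_comp]
  have hM : ∀ α : Fin p, (Matrix.of fun a b => ∑ j : Fin (3 * n),
      A a (e (Sum.inr (α, j))) * B b (e (Sum.inr (α, j))) * (fun _ : Fin p × Fin (3 * n) => (1 : K))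
        (α, j)).rank ≤ n := fun α =>
    (Matrix.rank_le_width _).trans le_rfl
  have h := thm63_rankDecomposition_blocks (K := K) (σ₀ := Fin (r - 3 * n * p)) (τ := Fin (3 * n))
    p (T := X) (A := fun a k => A a (e k)) (B := fun b k => B b (e k)) (C₀ := fun c k => C c (e k))
    hX'' (c' := fun _ => (1 : K)) (fun _ => one_ne_zero) (s := n) hM
  have hc1 : Fintype.card (Fin (r - 3 * n * p)) + p * Fintype.card (Fin (3 * n)) = r := by
    rw [Fintype.card_fin, Fintype.card_fin, Nat.mul_comm p]; omega
  have hc2 : Fintype.card (Fin (3 * n)) + n - (Fintype.card (Fin n) + Fintype.card (Fin n)) = 2 * n := by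
    rw [Fintype.card_fin, Fintype.card_fin]; omega
  rw [hc1, hc2] at h
  exact h

/-- **The display `T ⊕ p⊙⟨1,2n,1⟩ ⊴ ⟨r⟩ ⊕ p⊙⟨1,n,1⟩`** for `T ⊴ ⟨r⟩` (border rank `≤ r`) and
`3np ≤ r`: the `λ`-free display over the field `L = K(λ)` for the border-rank data
`T_λ = λ^h T + O(λ^{h+1})`, the slice block rescaled by `λ^h`, bootstrapped to `K` (Cor. 5.1).
[cite: AlmanLi2026, §6 (display after the proofs of Thm. 6.3)] -/
theorem blocks_degeneration {n r p : ℕ} (T : Fin n → Fin n → Fin n → K)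
    (hT : AlgDegeneratesTo (unitTensor K r) T) (hp : 3 * n * p ≤ r) :
    AlgDegeneratesTo
      (directSumTensor (unitTensor K r)
        (kroneckerTensor (unitTensor K p) (rotate (oneSliceTensor K (Fin n)))))
      (directSumTensor T
        (kroneckerTensor (unitTensor K p) (rotate (oneSliceTensor K (Fin (2 * n)))))) := by
  classical
  obtain ⟨h, P, hP, hres⟩ := exists_polynomialFamily_of_algDegeneratesTo_unit hT
  have hscale := restrictsTo_directSum_X_pow_mul (L := RatFunc K) P
    (kroneckerTensor (unitTensor K p) (rotate (oneSliceTensor K (Fin (2 * n))))) h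
  rw [map_unit_kronecker_rotate_oneSlice₆] at hscale
  have hdegL := ((blocks_degeneration_of_restrictsTo (RatFunc K) _ hres hp).trans_restrictsTo
    hscale)
  rw [directSum_unit_blocks_eq_map₆ (K := K)] at hdegL
  exact algDegeneratesTo_of_isFractionRing (K := K) (L := RatFunc K)
    (coeff_directSum_X_pow_mul P _ hP) hdegL

end Blocks

/-! ## Strassen calculus -/

section Spectral

variable {K : Type} [Field K] {F : SpectralMap K} (hF : IsUniversalSpectralPoint K F)
include hF

/-- **"and similar statements hold for the other two directions. Strassen calculus then yields …"**:
at a universal spectral point `φ` with exponents `θ`, for cubic `T` with `T ⊴ ⟨r⟩` and `3np ≤ r`: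
`φ(T) + p·(2n)^{θᵢ} ≤ r + p·n^{θᵢ}` for `i = 0, 1, 2` (border-rank decompositions rotate).
[cite: AlmanLi2026, §6 (display after the proofs of Thm. 6.3)] -/
theorem thm63_spectral {n r p : ℕ} (hn : 1 ≤ n) (T : Fin n → Fin n → Fin n → K)
    (hT : AlgDegeneratesTo (unitTensor K r) T) (hp : 3 * n * p ≤ r) (i : Fin 3) :
    F T + p * ((2 * n : ℕ) : ℝ) ^ specMMPoint K F i ≤ r + p * (n : ℝ) ^ specMMPoint K F i := by
  have h2n : 1 ≤ 2 * n := by omega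
  have hT₁ : AlgDegeneratesTo (unitTensor K r) (rotate T) := by
    simpa only [rotate_unit₆] using algDegeneratesTo_rotate_modes hT
  have hT₂ : AlgDegeneratesTo (unitTensor K r) (rotate (rotate T)) := by
    simpa only [rotate_unit₆] using algDegeneratesTo_rotate_modes hT₁
  -- the three degenerations: for `T`, `rotate T` (rotated twice), `rotate² T` (rotated once)
  have d₀ := blocks_degeneration K T hT hp
  have d₁ := algDegeneratesTo_rotate_modes (algDegeneratesTo_rotate_modes
    (blocks_degeneration K (rotate T) hT₁ hp))
  have d₂ := algDegeneratesTo_rotate_modes (blocks_degeneration K (rotate (rotate T)) hT₂ hp)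
  simp only [rotate_directSum₆, rotate_kronecker₆, rotate_unit₆, rotate_rotate_rotate₆] at d₁ d₂
  fin_cases i
  · have h := hF.mono_of_algDegeneratesTo d₀
    rw [hF.map_directSum, hF.map_directSum, hF.map_kronecker, hF.map_kronecker, hF.map_unitTensor,
      hF.map_unitTensor, (map_oneSlice_directions hF hn).1, (map_oneSlice_directions hF h2n).1] at h
    simpa using h
  · have h := hF.mono_of_algDegeneratesTo d₁
    rw [hF.map_directSum, hF.map_directSum, hF.map_kronecker, hF.map_kronecker, hF.map_unitTensor,
      hF.map_unitTensor, (map_oneSlice_directions hF hn).2.1,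
      (map_oneSlice_directions hF h2n).2.1] at h
    simpa using h
  · have h := hF.mono_of_algDegeneratesTo d₂
    rw [hF.map_directSum, hF.map_directSum, hF.map_kronecker, hF.map_kronecker, hF.map_unitTensor,
      hF.map_unitTensor, (map_oneSlice_directions hF hn).2.2,
      (map_oneSlice_directions hF h2n).2.2] at h
    simpa using h

/-- At a spectral point: `φ(T) ≤ r − (2^{2/3} − 1)·p·n^{2/3}` (largest exponent `≥ 2/3`, `τ`
increasing). [cite: AlmanLi2026, §6 (display after the proofs of Thm. 6.3)] -/
theorem thm63_pointwise {n r p : ℕ} (hn : 1 ≤ n) (T : Fin n → Fin n → Fin n → K)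
    (hT : AlgDegeneratesTo (unitTensor K r) T) (hp : 3 * n * p ≤ r) :
    F T ≤ r - ((2 : ℝ) ^ ((2 : ℝ) / 3) - 1) * p * (n : ℝ) ^ ((2 : ℝ) / 3) := by
  set θ := specMMPoint K F with hθdef
  obtain ⟨i₀, -, hi₀⟩ := Finset.exists_max_image Finset.univ θ Finset.univ_nonempty
  have hge : 2 / 3 ≤ θ i₀ := by
    have hsum : 2 ≤ ∑ i, θ i := AlmanLi2026.prop42_two_le_sum hF
    have h3 : ∑ i, θ i ≤ 3 * θ i₀ := by
      rw [Fin.sum_univ_three]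
      linarith [hi₀ 0 (Finset.mem_univ _), hi₀ 1 (Finset.mem_univ _), hi₀ 2 (Finset.mem_univ _)]
    linarith
  have h := thm63_spectral hF hn T hT hp i₀
  have hn1 : (1 : ℝ) ≤ n := by exact_mod_cast hn
  have hn2 : (n : ℝ) ≤ ((2 * n : ℕ) : ℝ) := by push_cast; linarith
  have hτ := rpow_sub_rpow_le_rpow_sub_rpow (s := ((2 * n : ℕ) : ℝ)) (t := (n : ℝ)) hn1 hn2
    (by norm_num : (0 : ℝ) ≤ 2 / 3) hge
  have hp0 : (0 : ℝ) ≤ p := Nat.cast_nonneg p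
  have e : ((2 * n : ℕ) : ℝ) ^ ((2 : ℝ) / 3) = (2 : ℝ) ^ ((2 : ℝ) / 3) * (n : ℝ) ^ ((2 : ℝ) / 3) := by
    push_cast
    exact Real.mul_rpow (by norm_num) (by linarith)
  rw [e] at hτ
  nlinarith [mul_le_mul_of_nonneg_left hτ hp0]

omit hF in
/-- **Alman–Li 2026, §6: `R̃(T) ≤ r − (2^{2/3} − 1)·p·n^{2/3}`** for every cubic tensor
`T : Fin n → Fin n → Fin n → K` (`n ≥ 1`) with `T ⊴ ⟨r⟩` and `3np ≤ r` (printed with `p = Ω(r/n)`,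
every `r_α ≥ 3n`). [cite: AlmanLi2026, §6 (display after the proofs of Thm. 6.3)] -/
theorem asymptoticRank_le_of_algDegeneratesTo_blocks {n r p : ℕ} (hn : 1 ≤ n)
    (T : Fin n → Fin n → Fin n → K) (hT : AlgDegeneratesTo (unitTensor K r) T) (hp : 3 * n * p ≤ r) :
    asymptoticRank T ≤ r - ((2 : ℝ) ^ ((2 : ℝ) / 3) - 1) * p * (n : ℝ) ^ ((2 : ℝ) / 3) :=
  strassen_duality_asymptoticRank.asymptoticRank_le (strassen_duality_asymptoticRank_holds K) T
    fun _ hF' => thm63_pointwise hF' hn T hT hp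

omit hF in
/-- The same bound from `bR(T) ≤ r` (the tree's `algBorderRank`, BCS (15.19): `bR(T) ≤ r ⟺ T ⊴ ⟨r⟩`).
[cite: AlmanLi2026, §6 (display after the proofs of Thm. 6.3)] -/
theorem asymptoticRank_le_of_algBorderRank_le_blocks {n r p : ℕ} (hn : 1 ≤ n)
    (T : Fin n → Fin n → Fin n → K) (hr : algBorderRank T ≤ r) (hp : 3 * n * p ≤ r) :
    asymptoticRank T ≤ r - ((2 : ℝ) ^ ((2 : ℝ) / 3) - 1) * p * (n : ℝ) ^ ((2 : ℝ) / 3) := by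
  classical
  exact asymptoticRank_le_of_algDegeneratesTo_blocks hn T
    (algDegeneratesTo_unitTensor_of_algBorderRank_le T hr) hp

omit hF in
/-- The same bound from a rank bound `R(T) ≤ r` (`R(T) ≤ r ⟹ ⟨r⟩ ≥ T ⟹ T ⊴ ⟨r⟩`).
[cite: AlmanLi2026, §6 (display after the proofs of Thm. 6.3)] -/
theorem asymptoticRank_le_of_tensorRank_le_blocks {n r p : ℕ} (hn : 1 ≤ n)
    (T : Fin n → Fin n → Fin n → K) (hr : tensorRank T ≤ r) (hp : 3 * n * p ≤ r) :
    asymptoticRank T ≤ r - ((2 : ℝ) ^ ((2 : ℝ) / 3) - 1) * p * (n : ℝ) ^ ((2 : ℝ) / 3) :=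
  asymptoticRank_le_of_algDegeneratesTo_blocks hn T
    (tensorRestrictsTo_unitTensor_of_tensorRank_le T hr).algDegeneratesTo hp

end Spectral

/-! ## Thm. 6.1's last clause ("In particular, if `r ≥ n` … for `r > 2n` …") -/

section ThmSixOne

variable (K : Type) [Field K]

/-- The "in particular" display of Thm. 6.1 for a cubic tensor with `⟨r⟩ ≥ X` (over any field):
`⟨r⟩ ⊕ ⟨n-slice⟩ ⊵ X ⊕ ⟨(r−n)-slice⟩` (`s = n ≥ rank M` automatically, `c' = 1`; slices with trivial
factor third). [cite: AlmanLi2026, Thm. 6.1 ("In particular, if r ≥ n")] -/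
theorem thm61_degeneration_of_restrictsTo {n r : ℕ} (X : Fin n → Fin n → Fin n → K)
    (hX : TensorRestrictsTo (unitTensor K r) X) :
    AlgDegeneratesTo (directSumTensor (unitTensor K r) (rotate (oneSliceTensor K (Fin n))))
      (directSumTensor X (rotate (oneSliceTensor K (Fin (r - n))))) := by
  classical
  obtain ⟨A, B, C, hABC⟩ := hX
  have hX' : ∀ a b c, X a b c = ∑ i, A a i * B b i * C c i := fun a b c => by
    rw [hABC, sum_unitTensor_eq₆]
  have hM : (Matrix.of fun a b => ∑ i : Fin r, A a i * B b i * (fun _ : Fin r => (1 : K)) i).rank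
      ≤ n := (Matrix.rank_le_width _).trans le_rfl
  have h := thm61_rankDecomposition_fintype (K := K) (σ := Fin r) (T := X) hX'
    (c' := fun _ => (1 : K)) (fun _ => one_ne_zero) hM
  have hc1 : Fintype.card (Fin r) = r := Fintype.card_fin r
  have hc2 : Fintype.card (Fin r) + n - (Fintype.card (Fin n) + Fintype.card (Fin n)) = r - n := by
    rw [Fintype.card_fin, Fintype.card_fin]; omega
  rw [hc2, hc1] at h
  exact h

/-- **Alman–Li 2026, Thm. 6.1, "In particular, if `r ≥ n`, we have
`T ⊕ ⟨1, r−n, 1⟩ ⊴ ⟨r⟩ ⊕ ⟨1, n, 1⟩`"** for `T ⊴ ⟨r⟩` (border rank `≤ r`): the display over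
`L = K(λ)` for the border-rank data, the slice rescaled by `λ^h`, bootstrapped to `K` (Cor. 5.1).
(For `r < n` the appended slice `⟨(r−n)-slice⟩` is empty, truncated subtraction.)
[cite: AlmanLi2026, Thm. 6.1 ("In particular, if r ≥ n")] -/
theorem thm61_degeneration {n r : ℕ} (T : Fin n → Fin n → Fin n → K)
    (hT : AlgDegeneratesTo (unitTensor K r) T) :
    AlgDegeneratesTo (directSumTensor (unitTensor K r) (rotate (oneSliceTensor K (Fin n))))
      (directSumTensor T (rotate (oneSliceTensor K (Fin (r - n))))) := by
  classical
  obtain ⟨h, P, hP, hres⟩ := exists_polynomialFamily_of_algDegeneratesTo_unit hT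
  have hscale := restrictsTo_directSum_X_pow_mul (L := RatFunc K) P
    (rotate (oneSliceTensor K (Fin (r - n)))) h
  rw [map_rotate_oneSlice₆] at hscale
  have hdegL := ((thm61_degeneration_of_restrictsTo (RatFunc K) _ hres).trans_restrictsTo hscale)
  rw [directSum_unit_slice_eq_map₆ (K := K)] at hdegL
  exact algDegeneratesTo_of_isFractionRing (K := K) (L := RatFunc K)
    (coeff_directSum_X_pow_mul P _ hP) hdegL

/-- **Alman–Li 2026, Thm. 6.1 as printed (border-rank data and a functional over `𝔽(λ)`)**: let
`T` be an `n × m × ·` tensor over `K` with `T ⊴ ⟨r⟩` presented by its border-rank data — a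
`K[λ]`-tensor `P = λ^h T + O(λ^{h+1})` whose image over `L = K(λ)` has the rank-`|σ|` decomposition
`∑ᵢ uᵢ ⊗ vᵢ ⊗ wᵢ` ("the `𝔽(λ)`-vectors representing the border rank decomposition") — and let
`c'ᵢ ∈ L ∖ {0}` with `rank (∑ᵢ c'ᵢ uᵢvᵢᵀ) ≤ s`.  Then `T ⊕ ⟨1, |σ| + s − (n+m), 1⟩ ⊴ ⟨|σ|⟩ ⊕ ⟨1, s, 1⟩`
over `K` (slices with trivial factor third; truncated subtraction): the `λ`-free theorem
(`thm61_rankDecomposition_fintype`) over the field `L`, the slice rescaled by `λ^h`, Cor. 5.1.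
[cite: AlmanLi2026, Thm. 6.1] -/
theorem thm61_degeneration_of_decomposition {ι' κ' μ' σ : Type} [Fintype ι'] [Fintype κ']
    [Fintype μ'] [DecidableEq ι'] [DecidableEq κ'] [DecidableEq μ'] [Fintype σ]
    {T : ι' → κ' → μ' → K} {P : ι' → κ' → μ' → K[X]} {h : ℕ}
    (hP : ∀ a b c, ∀ j ≤ h, (P a b c).coeff j = if j = h then T a b c else 0)
    {u : σ → ι' → RatFunc K} {v : σ → κ' → RatFunc K} {w : σ → μ' → RatFunc K}
    (hdec : ∀ a b c, algebraMap K[X] (RatFunc K) (P a b c) = ∑ i, u i a * v i b * w i c)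
    {c' : σ → RatFunc K} (hc' : ∀ i, c' i ≠ 0) {s : ℕ}
    (hM : (Matrix.of fun a b => ∑ i, u i a * v i b * c' i).rank ≤ s) :
    AlgDegeneratesTo
      (directSumTensor (unitTensor K (Fintype.card σ)) (rotate (oneSliceTensor K (Fin s))))
      (directSumTensor T (rotate (oneSliceTensor K
        (Fin (Fintype.card σ + s - (Fintype.card ι' + Fintype.card κ')))))) := by
  classical
  have hL := thm61_rankDecomposition_fintype (K := RatFunc K) (σ := σ)
    (T := fun a b c => algebraMap K[X] (RatFunc K) (P a b c))
    (A := fun a i => u i a) (B := fun b i => v i b) (C₀ := fun c i => w i c) hdec hc' hM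
  have hscale := restrictsTo_directSum_X_pow_mul (L := RatFunc K) P
    (rotate (oneSliceTensor K
      (Fin (Fintype.card σ + s - (Fintype.card ι' + Fintype.card κ'))))) h
  rw [map_rotate_oneSlice₆] at hscale
  have hdegL := hL.trans_restrictsTo hscale
  rw [directSum_unit_slice_eq_map₆ (K := K)] at hdegL
  exact algDegeneratesTo_of_isFractionRing (K := K) (L := RatFunc K)
    (coeff_directSum_X_pow_mul P _ hP) hdegL

variable {K}

/-- **Alman–Li 2026, Thm. 6.1, last clause**: for a cubic tensor `T : Fin n → Fin n → Fin n → K`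
with `T ⊴ ⟨r⟩`, `n ≥ 1` and `r > 2n`, `R̃(T) ≤ r + n^{2/3} − (r−n)^{2/3}` ("for `r > 2n`, this
provides the strict improvement `R̃(T) ≤ r + n^{2/3} − (r−n)^{2/3} < r`"): the display in the three
directions (border-rank decompositions rotate) and Prop. 4.5, Case 1 (`AlmanLi2026.prop45_of_lt`,
`t = r − n > s = n`). [cite: AlmanLi2026, Thm. 6.1 (last display)] -/
theorem thm61_asymptoticRank_le {n r : ℕ} (hn : 1 ≤ n) (hr2 : 2 * n < r)
    (T : Fin n → Fin n → Fin n → K) (hT : AlgDegeneratesTo (unitTensor K r) T) :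
    asymptoticRank T ≤ r + ((n : ℝ) ^ (2 / 3 : ℝ) - ((r - n : ℕ) : ℝ) ^ (2 / 3 : ℝ)) := by
  classical
  have hT₁ : AlgDegeneratesTo (unitTensor K r) (rotate T) := by
    simpa only [rotate_unit₆] using algDegeneratesTo_rotate_modes hT
  have hT₂ : AlgDegeneratesTo (unitTensor K r) (rotate (rotate T)) := by
    simpa only [rotate_unit₆] using algDegeneratesTo_rotate_modes hT₁
  have d₀ := thm61_degeneration K T hT
  have d₁ := algDegeneratesTo_rotate_modes (algDegeneratesTo_rotate_modes
    (thm61_degeneration K (rotate T) hT₁))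
  have d₂ := algDegeneratesTo_rotate_modes (thm61_degeneration K (rotate (rotate T)) hT₂)
  simp only [rotate_directSum₆, rotate_unit₆, rotate_rotate_rotate₆] at d₁ d₂
  refine AlmanLi2026.prop45_of_lt T hn (by omega) ?_ ?_ ?_
  · exact (((TensorRestrictsTo.refl _).directSum (tensorRestrictsTo_matMul_rotate₁ n)).algDegeneratesTo_trans
      d₀).trans_restrictsTo ((TensorRestrictsTo.refl _).directSum (tensorRestrictsTo_rotate₁_matMul _))
  · exact (((TensorRestrictsTo.refl _).directSum
      (tensorRestrictsTo_matMulTensor_oneSliceTensor (Function.Embedding.refl (Fin n)))).algDegeneratesTo_trans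
      d₁).trans_restrictsTo ((TensorRestrictsTo.refl _).directSum
        (tensorRestrictsTo_oneSliceTensor_matMulTensor (Equiv.refl _)))
  · exact (((TensorRestrictsTo.refl _).directSum (tensorRestrictsTo_matMul_rotate₂ n)).algDegeneratesTo_trans
      d₂).trans_restrictsTo ((TensorRestrictsTo.refl _).directSum (tensorRestrictsTo_rotate₂_matMul _))

/-- Thm. 6.1's last clause from `bR(T) ≤ r` (the tree's `algBorderRank`).
[cite: AlmanLi2026, Thm. 6.1 (last display)] -/
theorem thm61_asymptoticRank_le_of_algBorderRank_le {n r : ℕ} (hn : 1 ≤ n) (hr2 : 2 * n < r)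
    (T : Fin n → Fin n → Fin n → K) (hr : algBorderRank T ≤ r) :
    asymptoticRank T ≤ r + ((n : ℝ) ^ (2 / 3 : ℝ) - ((r - n : ℕ) : ℝ) ^ (2 / 3 : ℝ)) := by
  classical
  exact thm61_asymptoticRank_le hn hr2 T (algDegeneratesTo_unitTensor_of_algBorderRank_le T hr)

/-- Thm. 6.1's last clause from a rank bound `R(T) ≤ r`. [cite: AlmanLi2026, Thm. 6.1 (last display)] -/
theorem thm61_asymptoticRank_le_of_tensorRank_le {n r : ℕ} (hn : 1 ≤ n) (hr2 : 2 * n < r)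
    (T : Fin n → Fin n → Fin n → K) (hr : tensorRank T ≤ r) :
    asymptoticRank T ≤ r + ((n : ℝ) ^ (2 / 3 : ℝ) - ((r - n : ℕ) : ℝ) ^ (2 / 3 : ℝ)) :=
  thm61_asymptoticRank_le hn hr2 T (tensorRestrictsTo_unitTensor_of_tensorRank_le T hr).algDegeneratesTo

end ThmSixOne

end AlmanLi2026

end Literature.Computability.AlgebraicComplexity
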